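import Summits.CriticalPhenomena.PercolationContinuityZ3.Theorems.PercNearOneGluingNoHeavyLowerTailFKPhiMonotoneSharpness
import Summits.CriticalPhenomena.PercolationContinuityZ3.Theorems.Transplant.FKConnectivityAllQFastEvalBridge
import HarnessLib

/-!
# REFUTATION of the MEASURE-LEVEL cross-reach row X(v) (`K₁ ≥ 0`): an exact eight-vertex counterexample
# (PAPER-2 track (ii), refinements of the fibrewise hard-core Harris programme)

builds on p205010 (kernel theorem, internal audit signed; external expert review pending).  Support file (`--supports
stmt-CriticalPhenomena-4575`), lane `prim-facecert` (gen 16), answering LEAD-GEN106 NEXT SEAT (3) of `prim-nh-lead-4575`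
("measure-level IN(v)/X: proof or exact counterexample") for the cross-reach row; evidence `CROSSREACH-MEASURE-CEX.md` on stmt-4575;
companion of `…ConstsOneCopyContainMeasureRefutation.lean` (the containment row IN, same seat).  Every number below is an exact rational
decided by the KERNEL (`decide +kernel`; no `native_decide`); no definitions of mathematical content (only Boolean event predicates on the
`2¹¹` configurations of the listed pairs and a cheap mass function), no named facts, no sorries.

THE ROW.  `μ = prodBernoulli w`, source set `S`, target set `T`, `U = {S ↔ T}`, `D = Uᶜ = {S ↮ T}`, increasing cluster events `A = {P(C_S)}`,
`B = {Q(C_S)}`.  The lead's cross-reach row at measure level (LEAD-GEN106 §2(1), the `w = 1` stratum `K₁`; typed fibrewise as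
`Consts.CrossReachBHK`, refuted fibrewise at `n = 8` by `Consts.not_crossReachBHK`) is
  `X := 2·E⊗E[1_U(ω₀) 1_D(ω₁) ∇a ∇b] ≥ 0`, i.e. `μ(A∩U)·μ(B∩D) + μ(B∩U)·μ(A∩D) ≤ μ(A∩B∩U)·μ(D) + μ(A∩B∩D)·μ(U)`.
`Consts.crossReach_measure_of_disconnect_le` (prim-facecert g15, p338025) proves it under the hypothesis `μ(D) ≤ μ(U)`; this file shows the
hypothesis cannot be dropped.
THE MECHANISM — a PENDANT reduction to the containment row (lane memo FINDING-gen16 §2): if `v` is a pendant vertex with neighbour `h`,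
`w(hv) = t`, and `A, B` do not involve `v`, then with the rows of `G − v` at `h`,
  `X_G(v) = t·[X_{G−v}(h) + 2(1−t)·K₂(h)] → 2t·IN_{G−v}(h)` (`t → 0`),   `IN_G(v) = t·IN_{G−v}(h)`;
so the containment witness `G₇` (IN(0) = −2.9·10⁻¹³, K₂(0) = −3.1·10⁻¹¹) with a light pendant `07` is a cross-reach witness — which is also
how the lead's fibrewise `G₈ = G₇ + 07` arose.
THE WITNESS: `G₈ = {03, 04, 13, 15, 24, 25, 35, 45, 16, 56, 07}` on `Fin 8`, weights `w03 = w04 = 1/20, w13 = 1/10, w15 = 9/10, w24 = 1/20,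
w25 = 19/20, w35 = 17/20, w45 = 19/20, w16 = 3/20, w56 = 19/20, w07 = 1/200`, `S = {5}`, `T = {7}`, `P = [2 ∈ V(C)]`, `Q = [6 ∈ V(C)]`.  With every
probability an integer over `20¹⁰·200 = 2048000000000000`:  `μ(U) = 908779407804`, `μ(D) = 2047091220592196`, `μ(AU) = 865615137732`,
`μ(BU) = 869546588976`, `μ(ABU) = 828245757204`, `μ(AD) = 1949598937639068`, `μ(BD) = 1958685068267824`, `μ(ABD) = 1865403109502796`, and
  `μ(AU)μ(BD) + μ(BU)μ(AD) − μ(ABU)μ(D) − μ(ABD)μ(U) = +87941418257799/(131072·10²⁴) > 0`   (`X = −1.34·10⁻¹⁵`;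
`Consts.CrossReachMeasureCex.crossReach_measure_lt`).  Here `μ(U) = 4.4·10⁻⁴ ≪ ½`; on this `G₇` point the pendant must be light
(`t ≥ 1/100` gives `X > 0`); a nine-vertex "hub" witness with weights in `{4/5, 19/20, 1/5, 1/20, 1/50}` has `X = −1.4·10⁻¹³` (memo).
METHOD: as in `…ConstsThreeSepNegative.lean` / `…ConstsOneCopyContainMeasureRefutation.lean` — `FK.RCEval` at `q = 1`, masses as `2048`-term sums
of products of eleven rationals; the events are read by fk-1 g17's FAST bitmask evaluator `FK.RCEval.joinedB ∘ compsOf` (`joinedB_iff`, through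
`maskOf`/`tOf_maskOf`) — the open-walk reader `reachB` of the seven-vertex files does not scale to `2¹¹` configurations on eight vertices — and
`FK.exists_mem_openEdgeCluster_iff`.
CLASSIFICATION: refuted-substantive (house conjecture; with IT and the containment row the MEASURE-LEVEL strata table of LEAD-GEN106 §7 is
complete: `K₀`, `K₀ + K₁/2`, `K₀ + K₁`, `K₀+K₁+K₂` and `K₁ | μ(U) ≥ ½` are theorems, `K₂`, `K₂ + K₁/2`, `K₁` are false; the only repair in
sight is the proved hypothesis `μ(S ↮ T) ≤ μ(S ↔ T)`).
[cite: VandenbergHaggstromKahn2005, Thm. 1.3 (p. 6) with Remark 1 after Thm. 1.2 (p. 5)] [cite: Grimmett2006, §1.4 eq. (1.20) (p. 15)]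
-/

namespace Summit.CriticalPhenomena.PercolationContinuityZ3.Theorems

namespace Consts

open MeasureTheory Literature.Probability.LatticeModels Literature.Probability.Percolation

namespace CrossReachMeasureCex

/-- The witness as listed data: `G₈ = G₇ + 07` on `Fin 8`, pairs `03, 04, 13, 15, 24, 25, 35, 45, 16, 56, 07` with weights
`1/20, 1/20, 1/10, 9/10, 1/20, 19/20, 17/20, 19/20, 3/20, 19/20, 1/200`, cluster weight `q = 1`. (this seat, gen 16) -/
abbrev G : FK.RCEval := ⟨8, 11, ![0, 0, 1, 1, 2, 2, 3, 4, 1, 5, 0], ![3, 4, 3, 5, 4, 5, 5, 5, 6, 6, 7],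
  ![1 / 20, 1 / 20, 1 / 10, 9 / 10, 1 / 20, 19 / 20, 17 / 20, 19 / 20, 3 / 20, 19 / 20, 1 / 200], 1⟩

/-- The listing is valid. [folklore] -/
theorem G_valid : G.Valid := by decide +kernel

/-! ### Cheap masses (`q = 1`: no cluster count) and the event predicates by open walks -/

/-- `Σ_t [P t] · ∏_i (c_i or 1 − c_i)` — the mass of a predicate under the product weights (computable, no cluster count). [folklore] -/
def massW (P : Finset (Fin 11) → Bool) : ℚ := ∑ t : Finset (Fin 11), if P t then G.wQ t else 0

/-- At `q = 1`, `massQ = massW`. [folklore] -/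
theorem massQ_eq_massW (P : Finset (Fin 11) → Bool) : G.massQ P = massW P := by
  unfold FK.RCEval.massQ massW FK.RCEval.mQ
  refine Finset.sum_congr rfl fun t _ => ?_
  have hq : G.q = 1 := rfl
  rw [hq, one_pow, mul_one]

/-- At `q = 1`, `ZQ = Σ_t wQ t`. [folklore] -/
theorem zq_eq : G.ZQ = massW (fun _ => true) := by
  unfold FK.RCEval.ZQ massW FK.RCEval.mQ
  refine Finset.sum_congr rfl fun t _ => ?_
  have hq : G.q = 1 := rfl
  rw [hq, one_pow, mul_one, if_pos rfl]

/-- **Fast reachability reader**: `x ↔ y` in the configuration indexed by `t`, by the bitmask breadth-first evaluator of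
`…Transplant.FKConnectivityAllQFastEval*.lean` on the mask of `t`. [folklore] -/
def jn (t : Finset (Fin 11)) (x y : Fin 8) : Bool := FK.RCEval.joinedB (G.compsOf (G.maskOf t)) x.val y.val

/-- `U = {5 ↔ 7}`. -/
def pU (t : Finset (Fin 11)) : Bool := jn t 5 7
/-- `D = {5 ↮ 7}`. -/
def pD (t : Finset (Fin 11)) : Bool := !jn t 5 7
/-- `A ∩ U` (`A = {5 ↔ 2}`). -/
def pAU (t : Finset (Fin 11)) : Bool := jn t 5 2 && jn t 5 7
/-- `B ∩ U` (`B = {5 ↔ 6}`). -/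
def pBU (t : Finset (Fin 11)) : Bool := jn t 5 6 && jn t 5 7
/-- `A ∩ B ∩ U`. -/
def pABU (t : Finset (Fin 11)) : Bool := (jn t 5 2 && jn t 5 6) && jn t 5 7
/-- `A ∩ D`. -/
def pAD (t : Finset (Fin 11)) : Bool := jn t 5 2 && !jn t 5 7
/-- `B ∩ D`. -/
def pBD (t : Finset (Fin 11)) : Bool := jn t 5 6 && !jn t 5 7
/-- `A ∩ B ∩ D`. -/
def pABD (t : Finset (Fin 11)) : Bool := (jn t 5 2 && jn t 5 6) && !jn t 5 7

/-! ### Kernel arithmetic (`decide +kernel`, `2¹¹` configurations each: bitmask closures and products of eleven rationals) -/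

set_option maxHeartbeats 0 in
/-- `Z = 1`. [folklore] -/
theorem massW_true : massW (fun _ => true) = 1 := by decide +kernel
set_option maxHeartbeats 0 in
/-- mass of `U`. (this seat, gen 16; two independent exact engines agree) -/
theorem mass_U : massW pU = 908779407804 / 2048000000000000 := by decide +kernel
set_option maxHeartbeats 0 in
/-- mass of `D`. (this seat, gen 16; two independent exact engines agree) -/
theorem mass_D : massW pD = 2047091220592196 / 2048000000000000 := by decide +kernel
set_option maxHeartbeats 0 in
/-- mass of `A ∩ U`. (this seat, gen 16; two independent exact engines agree) -/
theorem mass_AU : massW pAU = 865615137732 / 2048000000000000 := by decide +kernel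
set_option maxHeartbeats 0 in
/-- mass of `B ∩ U`. (this seat, gen 16; two independent exact engines agree) -/
theorem mass_BU : massW pBU = 869546588976 / 2048000000000000 := by decide +kernel
set_option maxHeartbeats 0 in
/-- mass of `A ∩ B ∩ U`. (this seat, gen 16; two independent exact engines agree) -/
theorem mass_ABU : massW pABU = 828245757204 / 2048000000000000 := by decide +kernel
set_option maxHeartbeats 0 in
/-- mass of `A ∩ D`. (this seat, gen 16; two independent exact engines agree) -/
theorem mass_AD : massW pAD = 1949598937639068 / 2048000000000000 := by decide +kernel
set_option maxHeartbeats 0 in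
/-- mass of `B ∩ D`. (this seat, gen 16; two independent exact engines agree) -/
theorem mass_BD : massW pBD = 1958685068267824 / 2048000000000000 := by decide +kernel
set_option maxHeartbeats 0 in
/-- mass of `A ∩ B ∩ D`. (this seat, gen 16; two independent exact engines agree) -/
theorem mass_ABD : massW pABD = 1865403109502796 / 2048000000000000 := by decide +kernel

/-! ### From open walks to the events of the statement -/

/-- The fast reader reads open reachability in the listed configuration. [folklore] -/
theorem reach_iff (t : Finset (Fin 11)) (a b : Fin 8) :
    (openGraph (V := Fin 8) (G.conf t)).Reachable a b ↔ jn t a b = true := by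
  unfold jn
  rw [FK.RCEval.joinedB_iff (D := G) (G.maskOf t) a b, FK.RCEval.tOf_maskOf]

/-- Reading of `U = {∃ s ∈ {5}, ∃ t ∈ {7}, s ↔ t}`, `D = {∀ s ∈ {5}, ∀ t ∈ {7}, s ↮ t}`, `A = [2 ∈ V(C_{5})]`, `B = [6 ∈ V(C_{5})]`. [folklore] -/
theorem read8 (ω : BondConfig (Fin 8)) :
    ((∃ s ∈ ({5} : Set (Fin 8)), ∃ t ∈ ({7} : Set (Fin 8)), (openGraph ω).Reachable s t) ↔ (openGraph ω).Reachable 5 7) ∧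
      ((∀ s ∈ ({5} : Set (Fin 8)), ∀ t ∈ ({7} : Set (Fin 8)), ¬ (openGraph ω).Reachable s t) ↔ ¬ (openGraph ω).Reachable 5 7) ∧
      ((∃ e ∈ ⋃ s ∈ ({5} : Set (Fin 8)), openEdgeCluster ω s, (2 : Fin 8) ∈ e) ↔ (openGraph ω).Reachable 5 2) ∧
      ((∃ e ∈ ⋃ s ∈ ({5} : Set (Fin 8)), openEdgeCluster ω s, (6 : Fin 8) ∈ e) ↔ (openGraph ω).Reachable 5 6) := by
  have h25 : (2 : Fin 8) ≠ 5 := by decide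
  have h65 : (6 : Fin 8) ≠ 5 := by decide
  refine ⟨?_, ?_, ?_, ?_⟩
  · simp only [Set.mem_singleton_iff, exists_eq_left]
  · simp only [Set.mem_singleton_iff, forall_eq]
  · rw [Set.biUnion_singleton]; exact FK.exists_mem_openEdgeCluster_iff ω h25
  · rw [Set.biUnion_singleton]; exact FK.exists_mem_openEdgeCluster_iff ω h65

/-- A Boolean reading of a negated reachability. [folklore] -/
theorem not_iff_bnot {b : Bool} {p : Prop} (h : p ↔ b = true) : (¬ p) ↔ (!b) = true := by
  rw [h]; cases b <;> simp

/-- Membership in `U`. -/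
theorem mem_U (t : Finset (Fin 11)) : G.conf t ∈ {ω : BondConfig (Fin 8) | ∃ s ∈ ({5} : Set (Fin 8)), ∃ t ∈ ({7} : Set (Fin 8)), (openGraph ω).Reachable s t} ↔ pU t = true := by
  rw [Set.mem_setOf_eq, (read8 _).1, reach_iff]; rfl

/-- Membership in `D`. -/
theorem mem_D (t : Finset (Fin 11)) : G.conf t ∈ {ω : BondConfig (Fin 8) | ∀ s ∈ ({5} : Set (Fin 8)), ∀ t ∈ ({7} : Set (Fin 8)), ¬ (openGraph ω).Reachable s t} ↔ pD t = true := by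
  rw [Set.mem_setOf_eq, (read8 _).2.1, not_iff_bnot (reach_iff t 5 7)]; rfl

/-- Membership in `A ∩ U`. -/
theorem mem_AU (t : Finset (Fin 11)) : G.conf t ∈ ({ω : BondConfig (Fin 8) | ∃ e ∈ ⋃ s ∈ ({5} : Set (Fin 8)), openEdgeCluster ω s, (2 : Fin 8) ∈ e} ∩ {ω | ∃ s ∈ ({5} : Set (Fin 8)), ∃ t ∈ ({7} : Set (Fin 8)), (openGraph ω).Reachable s t}) ↔ pAU t = true := by
  rw [Set.mem_inter_iff, Set.mem_setOf_eq, Set.mem_setOf_eq, (read8 _).2.2.1, (read8 _).1, reach_iff, reach_iff]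
  unfold pAU; rw [Bool.and_eq_true]

/-- Membership in `B ∩ U`. -/
theorem mem_BU (t : Finset (Fin 11)) : G.conf t ∈ ({ω : BondConfig (Fin 8) | ∃ e ∈ ⋃ s ∈ ({5} : Set (Fin 8)), openEdgeCluster ω s, (6 : Fin 8) ∈ e} ∩ {ω | ∃ s ∈ ({5} : Set (Fin 8)), ∃ t ∈ ({7} : Set (Fin 8)), (openGraph ω).Reachable s t}) ↔ pBU t = true := by
  rw [Set.mem_inter_iff, Set.mem_setOf_eq, Set.mem_setOf_eq, (read8 _).2.2.2, (read8 _).1, reach_iff, reach_iff]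
  unfold pBU; rw [Bool.and_eq_true]

/-- Membership in `A ∩ B ∩ U`. -/
theorem mem_ABU (t : Finset (Fin 11)) : G.conf t ∈ ({ω : BondConfig (Fin 8) | ∃ e ∈ ⋃ s ∈ ({5} : Set (Fin 8)), openEdgeCluster ω s, (2 : Fin 8) ∈ e} ∩ {ω | ∃ e ∈ ⋃ s ∈ ({5} : Set (Fin 8)), openEdgeCluster ω s, (6 : Fin 8) ∈ e} ∩ {ω | ∃ s ∈ ({5} : Set (Fin 8)), ∃ t ∈ ({7} : Set (Fin 8)), (openGraph ω).Reachable s t}) ↔ pABU t = true := by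
  rw [Set.mem_inter_iff, Set.mem_inter_iff, Set.mem_setOf_eq, Set.mem_setOf_eq, Set.mem_setOf_eq, (read8 _).2.2.1, (read8 _).2.2.2,
    (read8 _).1, reach_iff, reach_iff, reach_iff]
  unfold pABU; rw [Bool.and_eq_true, Bool.and_eq_true]

/-- Membership in `A ∩ D`. -/
theorem mem_AD (t : Finset (Fin 11)) : G.conf t ∈ ({ω : BondConfig (Fin 8) | ∃ e ∈ ⋃ s ∈ ({5} : Set (Fin 8)), openEdgeCluster ω s, (2 : Fin 8) ∈ e} ∩ {ω | ∀ s ∈ ({5} : Set (Fin 8)), ∀ t ∈ ({7} : Set (Fin 8)), ¬ (openGraph ω).Reachable s t}) ↔ pAD t = true := by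
  rw [Set.mem_inter_iff, Set.mem_setOf_eq, Set.mem_setOf_eq, (read8 _).2.2.1, (read8 _).2.1, reach_iff, not_iff_bnot (reach_iff t 5 7)]
  unfold pAD; rw [Bool.and_eq_true]

/-- Membership in `B ∩ D`. -/
theorem mem_BD (t : Finset (Fin 11)) : G.conf t ∈ ({ω : BondConfig (Fin 8) | ∃ e ∈ ⋃ s ∈ ({5} : Set (Fin 8)), openEdgeCluster ω s, (6 : Fin 8) ∈ e} ∩ {ω | ∀ s ∈ ({5} : Set (Fin 8)), ∀ t ∈ ({7} : Set (Fin 8)), ¬ (openGraph ω).Reachable s t}) ↔ pBD t = true := by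
  rw [Set.mem_inter_iff, Set.mem_setOf_eq, Set.mem_setOf_eq, (read8 _).2.2.2, (read8 _).2.1, reach_iff, not_iff_bnot (reach_iff t 5 7)]
  unfold pBD; rw [Bool.and_eq_true]

/-- Membership in `A ∩ B ∩ D`. -/
theorem mem_ABD (t : Finset (Fin 11)) : G.conf t ∈ ({ω : BondConfig (Fin 8) | ∃ e ∈ ⋃ s ∈ ({5} : Set (Fin 8)), openEdgeCluster ω s, (2 : Fin 8) ∈ e} ∩ {ω | ∃ e ∈ ⋃ s ∈ ({5} : Set (Fin 8)), openEdgeCluster ω s, (6 : Fin 8) ∈ e} ∩ {ω | ∀ s ∈ ({5} : Set (Fin 8)), ∀ t ∈ ({7} : Set (Fin 8)), ¬ (openGraph ω).Reachable s t}) ↔ pABD t = true := by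
  rw [Set.mem_inter_iff, Set.mem_inter_iff, Set.mem_setOf_eq, Set.mem_setOf_eq, Set.mem_setOf_eq, (read8 _).2.2.1, (read8 _).2.2.2,
    (read8 _).2.1, reach_iff, reach_iff, not_iff_bnot (reach_iff t 5 7)]
  unfold pABD; rw [Bool.and_eq_true, Bool.and_eq_true]

/-! ### The eight measures as real numbers -/

/-- At `q = 1` the random-cluster measure of the listing is the Bernoulli product measure. [cite: Grimmett2006, §1.3] -/
theorem rc_eq : rcMeasureW G.w ((G.q : ℚ) : ℝ) ∅ = prodBernoulli G.w := by
  have : ((G.q : ℚ) : ℝ) = 1 := by norm_num [G]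
  rw [this]; exact rcMeasureW_one G.w ∅

/-- `μ(U)` at the witness, exactly. -/
theorem real_U : (prodBernoulli G.w).real {ω : BondConfig (Fin 8) | ∃ s ∈ ({5} : Set (Fin 8)), ∃ t ∈ ({7} : Set (Fin 8)), (openGraph ω).Reachable s t} = ((908779407804 / 2048000000000000 : ℚ) : ℝ) := by
  have h := FK.RCEval.real_eq_massQ_div G_valid (mem_U)
  rw [rc_eq, massQ_eq_massW, mass_U, zq_eq, massW_true, div_one] at h
  exact h

/-- `μ(D)` at the witness, exactly. -/
theorem real_D : (prodBernoulli G.w).real {ω : BondConfig (Fin 8) | ∀ s ∈ ({5} : Set (Fin 8)), ∀ t ∈ ({7} : Set (Fin 8)), ¬ (openGraph ω).Reachable s t} = ((2047091220592196 / 2048000000000000 : ℚ) : ℝ) := by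
  have h := FK.RCEval.real_eq_massQ_div G_valid (mem_D)
  rw [rc_eq, massQ_eq_massW, mass_D, zq_eq, massW_true, div_one] at h
  exact h

/-- `μ(AU)` at the witness, exactly. -/
theorem real_AU : (prodBernoulli G.w).real ({ω : BondConfig (Fin 8) | ∃ e ∈ ⋃ s ∈ ({5} : Set (Fin 8)), openEdgeCluster ω s, (2 : Fin 8) ∈ e} ∩ {ω | ∃ s ∈ ({5} : Set (Fin 8)), ∃ t ∈ ({7} : Set (Fin 8)), (openGraph ω).Reachable s t}) = ((865615137732 / 2048000000000000 : ℚ) : ℝ) := by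
  have h := FK.RCEval.real_eq_massQ_div G_valid (mem_AU)
  rw [rc_eq, massQ_eq_massW, mass_AU, zq_eq, massW_true, div_one] at h
  exact h

/-- `μ(BU)` at the witness, exactly. -/
theorem real_BU : (prodBernoulli G.w).real ({ω : BondConfig (Fin 8) | ∃ e ∈ ⋃ s ∈ ({5} : Set (Fin 8)), openEdgeCluster ω s, (6 : Fin 8) ∈ e} ∩ {ω | ∃ s ∈ ({5} : Set (Fin 8)), ∃ t ∈ ({7} : Set (Fin 8)), (openGraph ω).Reachable s t}) = ((869546588976 / 2048000000000000 : ℚ) : ℝ) := by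
  have h := FK.RCEval.real_eq_massQ_div G_valid (mem_BU)
  rw [rc_eq, massQ_eq_massW, mass_BU, zq_eq, massW_true, div_one] at h
  exact h

/-- `μ(ABU)` at the witness, exactly. -/
theorem real_ABU : (prodBernoulli G.w).real ({ω : BondConfig (Fin 8) | ∃ e ∈ ⋃ s ∈ ({5} : Set (Fin 8)), openEdgeCluster ω s, (2 : Fin 8) ∈ e} ∩ {ω | ∃ e ∈ ⋃ s ∈ ({5} : Set (Fin 8)), openEdgeCluster ω s, (6 : Fin 8) ∈ e} ∩ {ω | ∃ s ∈ ({5} : Set (Fin 8)), ∃ t ∈ ({7} : Set (Fin 8)), (openGraph ω).Reachable s t}) = ((828245757204 / 2048000000000000 : ℚ) : ℝ) := by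
  have h := FK.RCEval.real_eq_massQ_div G_valid (mem_ABU)
  rw [rc_eq, massQ_eq_massW, mass_ABU, zq_eq, massW_true, div_one] at h
  exact h

/-- `μ(AD)` at the witness, exactly. -/
theorem real_AD : (prodBernoulli G.w).real ({ω : BondConfig (Fin 8) | ∃ e ∈ ⋃ s ∈ ({5} : Set (Fin 8)), openEdgeCluster ω s, (2 : Fin 8) ∈ e} ∩ {ω | ∀ s ∈ ({5} : Set (Fin 8)), ∀ t ∈ ({7} : Set (Fin 8)), ¬ (openGraph ω).Reachable s t}) = ((1949598937639068 / 2048000000000000 : ℚ) : ℝ) := by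
  have h := FK.RCEval.real_eq_massQ_div G_valid (mem_AD)
  rw [rc_eq, massQ_eq_massW, mass_AD, zq_eq, massW_true, div_one] at h
  exact h

/-- `μ(BD)` at the witness, exactly. -/
theorem real_BD : (prodBernoulli G.w).real ({ω : BondConfig (Fin 8) | ∃ e ∈ ⋃ s ∈ ({5} : Set (Fin 8)), openEdgeCluster ω s, (6 : Fin 8) ∈ e} ∩ {ω | ∀ s ∈ ({5} : Set (Fin 8)), ∀ t ∈ ({7} : Set (Fin 8)), ¬ (openGraph ω).Reachable s t}) = ((1958685068267824 / 2048000000000000 : ℚ) : ℝ) := by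
  have h := FK.RCEval.real_eq_massQ_div G_valid (mem_BD)
  rw [rc_eq, massQ_eq_massW, mass_BD, zq_eq, massW_true, div_one] at h
  exact h

/-- `μ(ABD)` at the witness, exactly. -/
theorem real_ABD : (prodBernoulli G.w).real ({ω : BondConfig (Fin 8) | ∃ e ∈ ⋃ s ∈ ({5} : Set (Fin 8)), openEdgeCluster ω s, (2 : Fin 8) ∈ e} ∩ {ω | ∃ e ∈ ⋃ s ∈ ({5} : Set (Fin 8)), openEdgeCluster ω s, (6 : Fin 8) ∈ e} ∩ {ω | ∀ s ∈ ({5} : Set (Fin 8)), ∀ t ∈ ({7} : Set (Fin 8)), ¬ (openGraph ω).Reachable s t}) = ((1865403109502796 / 2048000000000000 : ℚ) : ℝ) := by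
  have h := FK.RCEval.real_eq_massQ_div G_valid (mem_ABD)
  rw [rc_eq, massQ_eq_massW, mass_ABD, zq_eq, massW_true, div_one] at h
  exact h

/-! ### The refutation -/

/-- **The cross-reach row fails at the witness**: with `μ = prodBernoulli G.w`, `S = {5}`, `T = {7}`, `A = [2 ∈ V(C_S)]`, `B = [6 ∈ V(C_S)]`,
`U = {S ↔ T}`, `D = {S ↮ T}`:  `μ(A∩B∩U)·μ(D) + μ(A∩B∩D)·μ(U) < μ(A∩U)·μ(B∩D) + μ(B∩U)·μ(A∩D)` (margin `87941418257799/(131072·10²⁴) = 6.7·10⁻¹⁶`),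
i.e. `E⊗E[1_U(ω₀)1_D(ω₁) ∇a ∇b] < 0`. (this seat, gen 16) [cite: VandenbergHaggstromKahn2005, Thm. 1.3 (p. 6) with Remark 1 (p. 5)] -/
theorem crossReach_measure_lt :
    (prodBernoulli G.w).real ({ω : BondConfig (Fin 8) | ∃ e ∈ ⋃ s ∈ ({5} : Set (Fin 8)), openEdgeCluster ω s, (2 : Fin 8) ∈ e} ∩ {ω | ∃ e ∈ ⋃ s ∈ ({5} : Set (Fin 8)), openEdgeCluster ω s, (6 : Fin 8) ∈ e} ∩ {ω | ∃ s ∈ ({5} : Set (Fin 8)), ∃ t ∈ ({7} : Set (Fin 8)), (openGraph ω).Reachable s t}) * (prodBernoulli G.w).real {ω : BondConfig (Fin 8) | ∀ s ∈ ({5} : Set (Fin 8)), ∀ t ∈ ({7} : Set (Fin 8)), ¬ (openGraph ω).Reachable s t} +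
        (prodBernoulli G.w).real ({ω : BondConfig (Fin 8) | ∃ e ∈ ⋃ s ∈ ({5} : Set (Fin 8)), openEdgeCluster ω s, (2 : Fin 8) ∈ e} ∩ {ω | ∃ e ∈ ⋃ s ∈ ({5} : Set (Fin 8)), openEdgeCluster ω s, (6 : Fin 8) ∈ e} ∩ {ω | ∀ s ∈ ({5} : Set (Fin 8)), ∀ t ∈ ({7} : Set (Fin 8)), ¬ (openGraph ω).Reachable s t}) * (prodBernoulli G.w).real {ω : BondConfig (Fin 8) | ∃ s ∈ ({5} : Set (Fin 8)), ∃ t ∈ ({7} : Set (Fin 8)), (openGraph ω).Reachable s t} <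
      (prodBernoulli G.w).real ({ω : BondConfig (Fin 8) | ∃ e ∈ ⋃ s ∈ ({5} : Set (Fin 8)), openEdgeCluster ω s, (2 : Fin 8) ∈ e} ∩ {ω | ∃ s ∈ ({5} : Set (Fin 8)), ∃ t ∈ ({7} : Set (Fin 8)), (openGraph ω).Reachable s t}) * (prodBernoulli G.w).real ({ω : BondConfig (Fin 8) | ∃ e ∈ ⋃ s ∈ ({5} : Set (Fin 8)), openEdgeCluster ω s, (6 : Fin 8) ∈ e} ∩ {ω | ∀ s ∈ ({5} : Set (Fin 8)), ∀ t ∈ ({7} : Set (Fin 8)), ¬ (openGraph ω).Reachable s t}) +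
        (prodBernoulli G.w).real ({ω : BondConfig (Fin 8) | ∃ e ∈ ⋃ s ∈ ({5} : Set (Fin 8)), openEdgeCluster ω s, (6 : Fin 8) ∈ e} ∩ {ω | ∃ s ∈ ({5} : Set (Fin 8)), ∃ t ∈ ({7} : Set (Fin 8)), (openGraph ω).Reachable s t}) * (prodBernoulli G.w).real ({ω : BondConfig (Fin 8) | ∃ e ∈ ⋃ s ∈ ({5} : Set (Fin 8)), openEdgeCluster ω s, (2 : Fin 8) ∈ e} ∩ {ω | ∀ s ∈ ({5} : Set (Fin 8)), ∀ t ∈ ({7} : Set (Fin 8)), ¬ (openGraph ω).Reachable s t}) := by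
  rw [real_ABU, real_D, real_ABD, real_U, real_AU, real_BD, real_BU, real_AD]
  norm_num

end CrossReachMeasureCex

/-- **THEOREM: the measure-level CROSS-REACH row is NOT a law of percolation** — the hypothesis `μ(S ↮ T) ≤ μ(S ↔ T)` of
`Consts.crossReach_measure_of_disconnect_le` cannot be dropped.  It is false that for every finite weighted graph, source set `S`, target set
`T` and increasing cluster events `A = {P(C_S)}`, `B = {Q(C_S)}`,
`μ(A∩U)·μ(B∩D) + μ(B∩U)·μ(A∩D) ≤ μ(A∩B∩U)·μ(D) + μ(A∩B∩D)·μ(U)` (`U = {S ↔ T}`, `D = {S ↮ T}`); witness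
`Consts.CrossReachMeasureCex.crossReach_measure_lt` (`n = 8`, `S = {5}`, `T = {7}`, `P = [2 ∈ V(C)]`, `Q = [6 ∈ V(C)]`, `μ(U) ≈ 4.4·10⁻⁴`).
refuted-substantive. [cite: VandenbergHaggstromKahn2005, Thm. 1.3 (p. 6) with Remark 1 after Thm. 1.2 (p. 5)] -/
theorem not_crossReach_measure : ¬ (∀ (n : ℕ) (w : Sym2 (Fin n) → unitInterval) (S T : Set (Fin n))
    (P Q : Set (Sym2 (Fin n)) → Prop), (∀ ⦃C C' : Set (Sym2 (Fin n))⦄, C ⊆ C' → P C → P C') →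
    (∀ ⦃C C' : Set (Sym2 (Fin n))⦄, C ⊆ C' → Q C → Q C') →
    (prodBernoulli w).real ({ω : BondConfig (Fin n) | P (⋃ s ∈ S, openEdgeCluster ω s)} ∩
          {ω | ∃ s ∈ S, ∃ t ∈ T, (openGraph ω).Reachable s t}) *
        (prodBernoulli w).real ({ω : BondConfig (Fin n) | Q (⋃ s ∈ S, openEdgeCluster ω s)} ∩
          {ω | ∀ s ∈ S, ∀ t ∈ T, ¬ (openGraph ω).Reachable s t}) +
      (prodBernoulli w).real ({ω : BondConfig (Fin n) | Q (⋃ s ∈ S, openEdgeCluster ω s)} ∩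
          {ω | ∃ s ∈ S, ∃ t ∈ T, (openGraph ω).Reachable s t}) *
        (prodBernoulli w).real ({ω : BondConfig (Fin n) | P (⋃ s ∈ S, openEdgeCluster ω s)} ∩
          {ω | ∀ s ∈ S, ∀ t ∈ T, ¬ (openGraph ω).Reachable s t}) ≤
    (prodBernoulli w).real ({ω : BondConfig (Fin n) | P (⋃ s ∈ S, openEdgeCluster ω s)} ∩
          {ω | Q (⋃ s ∈ S, openEdgeCluster ω s)} ∩ {ω | ∃ s ∈ S, ∃ t ∈ T, (openGraph ω).Reachable s t}) *
        (prodBernoulli w).real {ω : BondConfig (Fin n) | ∀ s ∈ S, ∀ t ∈ T, ¬ (openGraph ω).Reachable s t} +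
      (prodBernoulli w).real ({ω : BondConfig (Fin n) | P (⋃ s ∈ S, openEdgeCluster ω s)} ∩
          {ω | Q (⋃ s ∈ S, openEdgeCluster ω s)} ∩ {ω | ∀ s ∈ S, ∀ t ∈ T, ¬ (openGraph ω).Reachable s t}) *
        (prodBernoulli w).real {ω : BondConfig (Fin n) | ∃ s ∈ S, ∃ t ∈ T, (openGraph ω).Reachable s t}) := by
  intro h
  have h8 := h 8 CrossReachMeasureCex.G.w {5} {7} (fun C => ∃ e ∈ C, (2 : Fin 8) ∈ e) (fun C => ∃ e ∈ C, (6 : Fin 8) ∈ e)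
    (fun _ _ hCC' ⟨e, he, h2⟩ => ⟨e, hCC' he, h2⟩) (fun _ _ hCC' ⟨e, he, h6⟩ => ⟨e, hCC' he, h6⟩)
  exact absurd h8 (not_le.2 CrossReachMeasureCex.crossReach_measure_lt)

end Consts

end Summit.CriticalPhenomena.PercolationContinuityZ3.Theorems
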